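import Summits.FinalStateConjecture.FinalStateConjecture.Theses.StorageCertificates
import Literature.Geometry.Lorentzian.TameGenericityDiagonal
import Literature.Geometry.Lorentzian.KerrSliceFacts
import Literature.Geometry.Lorentzian.LeviCivitaProofs

/-!
# Crux `FinalStateFromKerrCapture` — line `birth`: BIRTH SKELETON (BC3; skeleton registrar, 2026-08-17)

Crux item `stmt-FinalStateConjecture-10929`, decl (FIXED; concluded BY NAME in
`FinalStateFromKerrCapture_of`):
`Summit.FinalStateConjecture.FinalStateConjecture.Theses.StorageCertificates.FinalStateFromKerrCapture`,
route `route-FinalStateConjecture-StorageCertificates` (rev 10, crux rank 5): THE LARGE-DATA HALF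
`K → FinalStateConjecture`, where the waypoint `K` (spelled out inline in the route file) is
sub-extremal Kerr stability in consequence form — `∃ (s, δ, k) ∀ (M, a) sub-extremal ∀ η > 0
∃ ε > 0`: every vacuum datum on the horizon-penetrating Kerr–Schild slice `Kerr.slice a M`
(`r₀ := M ∈ (r₋, r₊)`) within `ε` of `Kerr.data M a M` in `H^s_δ × H^{s-1}_{δ+1}` has all its maximal
vacuum Cauchy developments (i) with sub-extremal `η`-close final parameters, (ii) with complete `𝓘⁺`
in the far-origin sojourn form, (iii) with SOME region `𝒟oc` converging in `Cᵏ` to `g_{M',a'}`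
(`Spacetime.ConvergesToKerr`, Kerr–Schild late-chart gauge).

## The cut — "K-basin | transfer | remainder": what the perturbative waypoint buys, exactly

Write `S(D)` for the summit's per-datum property (an MGHD exists; every MGHD has complete `𝓘⁺` and
an honest `C²` sub-extremal Kerr final-state decomposition of its self-determined exterior with
`RaysStayInClosure`, `HasExhaustiveCharts`, `IsFutureOriented`). `K` is a SMALL-DATA statement about
data on ONE Kerr–Schild slice type; the summit quantifies over complete one-ended
Dafermos–Rodnianski-admissible data on an arbitrary `X`. Two facts about the typing decide how `K`
can enter at all (registrar's analysis, recorded in `Lines/birth.md` §Why this cut):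

1. NO ADMISSIBLE DATUM IS ITSELF IN K's BALL. `Kerr.data M a M` has `k = O(r⁻²) ≠ o(r⁻²)`
   (`Kerr.not_isStronglyAsymptoticallyFlatDR_data`), admissible data have `k = o₁(r⁻²)`; the
   `H^{s-1}_{δ+1}` part of `dataWeightedSobolevEDist` of the difference is `≍ ∫^∞ r^{2δ} dr = ∞` for
   every `δ ≥ -1/2`, and for `δ < -1/2` the ball does not control the ADM mass (so `K`'s clause
   `|M' - M| ≤ η` is not credible there). Hence `K` can only be applied to data induced on OTHER
   hypersurfaces of a development — Kerr–Schild-type slices `Σ' ≅ Kerr.slice a M`, which near `i⁰`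
   tilt LOGARITHMICALLY to the past of every Dafermos–Rodnianski-admissible Cauchy surface
   (`t_BL = const - 2M log r` on `{t* = const}`): a capture slice is never contained in `J⁺(ι X)`;
   only its NEAR part is, and only TRUNCATED late Kerr–Schild slabs lie in `J⁺(ι X)` (which is why the
   summit certifies hole charts on truncated slabs and leaves the far zone to a flat chart).
2. LATE SLICES OF RADIATING DEVELOPMENTS NEVER ENTER K's BALL: an asymptotically flat `Σ'` (of
   either tilt) crosses every early outgoing radiation shell `{u = u₀}` at radius `r(u₀) ≳ T/2`, where
   the perturbation is `F^{(j)}(u₀)/r` with no gain of decay under `∂_r`, so its weighted Sobolev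
   distance to any Kerr datum grows like `T^{δ+1}`; "evolve, then capture" is not available for `K`
   as typed (it would need hyperboloidal or characteristic data).
3. WHAT `K` DOES SETTLE: developments containing a Kerr–Schild slice ALREADY in its ball — e.g. an
   admissible datum which on `{r > M}` is (`ε`-near) the induced data of ONE spacelike leaf of exact
   Kerr that is Kerr–Schild near the hole and bends to Boyer–Lindquist asymptotics far out (so that
   it is admissible), completed by a compact vacuum cap inside the trapped sphere `{r = M}` (cap
   fill-in by obstruction-free annular gluing, Czimek–Rodnianski arXiv:2210.09663, Mao–Oh–Tao
   arXiv:2308.13031): by domain of dependence its MGHD contains the exact Kerr–Schild slice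
   `{t* = 0} ∩ {r > M}` (re-entering the exact region below `Σ` far out), at distance `0` (resp.
   `O(ε)`). The summit OFF this basin is untouched by `K`.

So the only sound seam is: ONE generic statement off the basin + POINTWISE lemmas on the basin,
glued by monotonicity of `IsTameChristodoulouGeneric … 1` in the property (tame genericity is not
closed under `∧`; cf. `KerrBasinCapture/Lines/birth.lean`, `TameGenericityDiagonal`):

* `stub_mghdExists` (S0, classical, XL formalisation; SHARED verbatim with the route items
  `MGHDExists` of ExactKerrEnds / GlobalAttraction / EternalPapapetrou / BartnikGapSettling and with
  the registered skeletons of `GenericCensoredCapture`, `GenericCensoredHolesSettle`): every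
  admissible datum has a maximal vacuum Cauchy development (Choquet-Bruhat–Geroch 1969; Sbierski
  2016). `K` quantifies over maximal developments only and says nothing about their existence, which
  the summit's anti-vacuity conjunct demands.
* `stub_captureTransfer` (S1, POINTWISE, the stub that CONSUMES `K`'s output; L/XL): for an
  admissible `D`, an MGHD `𝒟` of `D`, a Kerr–Schild-type slice — a vacuum datum `D'` on
  `Kerr.slice a M` with a maximal development `𝒟'` isometrically, time-orientedly, openly embedded
  into `𝒟` with the NEAR part of the slice (`‖y‖ ≤ afRadius a M + 1`) to the future of `ι X` — IF `𝒟'` enjoys `K`'s conclusion in the weakest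
  form `K` guarantees (sub-extremal `(M', a')`, far-origin sojourn completeness, `C⁰` Kerr
  convergence of SOME region: the refuter's junk-weakness lemmas `convergesToKerr_zero_of`,
  `exists_convergesToKerr_iff` on this item, evidence Scratch.lean 2026-08-15, are honoured — S1 is
  handed nothing stronger), and IF `𝒟'` satisfies the ORIENTATION LEMMA (TRUNCATED late slabs of every late
  `C⁰`-Kerr embedding into `𝒟'` lie eventually in `J⁺` of the near part of its Cauchy slice, with
  `Ψ_* V_{M',a'}` future-directed there;
  `K`'s `ConvergesToKerr` pins no time orientation, exactly the gap the T2 audit closed at summit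
  level with `IsFutureOriented`) and `𝒟` the INTERIOR LEMMA (every honest `C²` decomposition keeps
  the future-complete null rays from `Σ` in the closure of its exterior; verbatim the hand-over
  clause of `KerrBasinCapture`), THEN `𝒟` satisfies the summit's per-development conclusion.
  Content: transfer of sojourn completeness from far origins on `Σ'` to far origins on `Σ`
  (monotone in the sojourn form), push-forward of the late Kerr chart, construction of the `N = 1`
  decomposition (flat chart = Kerr chart beyond sublinear excision, `g_{M',a'} - η = O(M'/r)`),
  HONEST horizon-filling recut (`HasExhaustiveCharts` fails for a chart missing a sliver outside
  `𝓗⁺`) with the far parts of the slabs bent into `J⁺(ι X)` beyond the certified radii (time shift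
  supported in `{r > R(t*)}`, so truncated deviations are untouched), and the `C⁰ ⇒ C²` regularity
  upgrade (vacuum + sub-extremal red shift; cf.
  `GlobalAttraction.SubextremalUpgrade`).
* `stub_largeDataRemainder` (S2, GENERIC, open problem = the summit off the K-basin): for all
  Sobolev scales `(s, δ)` and all positive threshold functions `ε(M, a, η)`, tame-generically in
  `admissibleVacuumData X`, a datum OUTSIDE the K-basin — the basin being: every MGHD contains a
  Kerr–Schild capture slice at scale `ε` (with its maximal development embedded, vacuum, oriented)
  and satisfies the interior lemma — satisfies `S`. `S2 ⟸ FinalStateConjecture` trivially (a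
  consequence of the summit USED toward the summit, lens `wuc`); it is summit-hard by nature and the
  skeleton does not hide it: for parameter values at which no admissible development is captured it
  IS the summit. This is the census of the crux: `K → FSC` = (S0 + S1 on the basin, discharged by
  `K`) + (FSC off the basin).

`FinalStateFromKerrCapture_of` (kernel-checked, no `sorry` of its own): discharge the instance
hypotheses `[Kerr.Facts] [Kerr.SliceFacts]` of `K` by the tree's theorems
(`Kerr.isConnected_region_holds`, `Kerr.contMDiff_bilin_holds`, `Kerr.contMDiff_timeVector_holds`,
`Kerr.sliceFacts_holds`); open `K` to `(s, δ, k)`; CHOOSE the threshold function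
`ε(M, a, η) := K's ε` (classical choice, `1` off the sub-extremal range); run S2 at these thresholds;
monotonicity of tame genericity with the pointwise implication: off the basin S2's conclusion is
`S(D)`; on the basin, S0 gives the MGHD, and for every MGHD `𝒟` the basin hands a captured slice
`(M, a, η, D', 𝒟', ψ)` with `dist < ε(M, a, η)`, `K` applied to `D'` (Levi-Civita instance by
`PseudoRiemannianMetric.hasLeviCivita`) and to the maximal `𝒟'` gives `(M', a', 𝒟oc)`, the `Cᵏ`
convergence is weakened to `C⁰` (`Spacetime.ConvergesTo.of_le`), and S1 returns the summit's
conclusion for `𝒟`. Sorries live only in the three stubs.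

## BC3 probes (seat folder `bc/probe_S{0,1,2}.lean`: they import the route file only — NOT this
## skeleton — so no sorried theorem is in scope; each restates the stub signature as a `def`)
`stub → FinalStateFromKerrCapture` and `stub → FinalStateConjecture` by
`first | exact? | simpa [S] | (unfold S; simpa) | aesop` (400 000 heartbeats): all six FAIL (log in
`Lines/birth.md`). No stub is cheaply the crux or the summit: S0 is MGHD existence; S1 is a pointwise
conditional that never meets a datum off the basin; S2 never settles a datum on the basin.

## Disproof used
None exists for this crux (`ledger crux ls stmt-FinalStateConjecture-10929`: no workfiles before this
one). Honoured instead: the refuter crux-attack on this item (evidence Scratch.lean, 2026-08-15: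
`iff_summit_of_K`, `exists_convergesToKerr_iff`, `convergesToKerr_zero_of`) — S1's hypothesis is the
`C⁰`, free-region form and the orientation gap is a NAMED hand-over clause, not assumed away. The
negatives index (`not_UniformPhotonSphereChannels`, item 10045) is unrelated; no stub instantiates
it. All stubs are typed over the T2 re-typed Statement (tame genericity on one fixed end — no burial
witnesses; honest radii; `RaysStayInClosure`; `IsFutureOriented`).
-/

noncomputable section

-- D-0017: single-problem summit, `Summit.<S>.<S>.…` by design (cf. lakefile `weak.linter.dupNamespace`).
set_option linter.dupNamespace false

namespace Summit.FinalStateConjecture.FinalStateConjecture.Cruxes.FinalStateFromKerrCapture.Birth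

open Set Filter Function Topology TopologicalSpace
open scoped Manifold ContDiff Classical ENNReal
open Literature.Geometry.Lorentzian

/-! ## §0 Vocabulary (readability; the composition uses it, NO registered stub signature does —
the stubs below are stated EXPANDED over Statement + Lorentz-prelude declarations) -/

section Vocabulary

variable {X : Type} [TopologicalSpace X] [ChartedSpace E3 X] [IsManifold (𝓡 3) ∞ X]
  [ConnectedSpace X]

/-- The summit's PER-DEVELOPMENT conclusion for a vacuum Cauchy development `𝒟` (verbatim the body
of `FinalStateConjecture` after `𝒟.IsMaximal →`): complete `𝓘⁺` and an honest `C²` sub-extremal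
Kerr final-state decomposition of the self-determined exterior. [cite: DafermosLuk2017, Conjecture 1] -/
def SummitConclusion {D : InitialDataSet (𝓡 3) X} (𝒟 : VacuumCauchyDevelopment D) : Prop :=
  Summit.FinalStateConjecture.HasCompleteNullInfinity 𝒟.toCauchyDevelopment ∧ ∃ (O : Set 𝒟.carrier) (d : FinalStateDecomposition 𝒟.toSpacetime O 2), (∀ i, Kerr.IsSubextremal (d.mass i) (d.spin i)) ∧ O = Summit.FinalStateConjecture.exteriorOf 𝒟.toCauchyDevelopment d.charted ∧ Summit.FinalStateConjecture.RaysStayInClosure 𝒟.toCauchyDevelopment O ∧ Summit.FinalStateConjecture.HasExhaustiveCharts d ∧ Summit.FinalStateConjecture.IsFutureOriented d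

/-- The summit's PER-DATUM property `S(D)` (verbatim the property of `FinalStateConjecture`): an MGHD
exists and every MGHD satisfies `SummitConclusion`. [cite: DafermosLuk2017, Conjecture 1] -/
def SummitProperty (D : InitialDataSet (𝓡 3) X) : Prop :=
  (∃ 𝒟 : VacuumCauchyDevelopment D, 𝒟.IsMaximal) ∧
    ∀ 𝒟 : VacuumCauchyDevelopment D, 𝒟.IsMaximal → SummitConclusion 𝒟

/-- INTERIOR LEMMA for `𝒟` (verbatim the hand-over clause of `KerrBasinCapture`): every honest `C²`
sub-extremal Kerr final-state decomposition of `𝒟` keeps the future-complete normalised null rays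
from `Σ` in the closure of its exterior. [cite: DafermosLuk2017, Conjecture 1] -/
def InteriorLemma {D : InitialDataSet (𝓡 3) X} (𝒟 : VacuumCauchyDevelopment D) : Prop :=
  ∀ (O : Set 𝒟.carrier) (d : FinalStateDecomposition 𝒟.toSpacetime O 2), (∀ i, Kerr.IsSubextremal (d.mass i) (d.spin i)) → O = Summit.FinalStateConjecture.exteriorOf 𝒟.toCauchyDevelopment d.charted → Summit.FinalStateConjecture.HasExhaustiveCharts d → Summit.FinalStateConjecture.IsFutureOriented d → Summit.FinalStateConjecture.RaysStayInClosure 𝒟.toCauchyDevelopment O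

variable [Kerr.SliceFacts]

/-- `ψ` EMBEDS the development `𝒟'` of the slice datum `D'` (on `Kerr.slice a M`) INTO `𝒟` AFTER THE
DATA: a smooth, open, isometric, time-orientation-preserving embedding of carriers which places the
NEAR part `ψ(ι' {y | ‖y‖ ≤ afRadius a M + 1})` of the slice in `J⁺(ι X)` (the far part of a
Kerr–Schild slice tilts logarithmically below any Dafermos–Rodnianski-admissible Cauchy surface and
cannot be asked to lie in `J⁺(ι X)`). The first four clauses are those of `DataEmbedding.EmbedsInto`,
across two data sets. [cite: Ringstrom2009, Def. 16.5] -/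
def EmbedsAfterData {M a : ℝ} {D' : InitialDataSet 𝓘(ℝ, E3) (Kerr.slice a M)}
    (𝒟' : VacuumCauchyDevelopment D') {D : InitialDataSet (𝓡 3) X} (𝒟 : VacuumCauchyDevelopment D)
    (ψ : 𝒟'.carrier → 𝒟.carrier) : Prop :=
  ContMDiff (𝓡 4) (𝓡 4) ∞ ψ ∧ Topology.IsOpenEmbedding ψ ∧ 𝒟'.metric.IsIsometricImmersion 𝒟.metric.toPseudoRiemannianMetric ψ ∧ 𝒟'.timeOrientation.PreservesTimeOrientation ψ 𝒟.timeOrientation ∧ ∀ y : Kerr.slice a M, ‖(y : E3)‖ ≤ Kerr.afRadius a M + 1 → ψ (𝒟'.embed y) ∈ 𝒟.metric.causalFuture 𝒟.timeOrientation (range 𝒟.embed)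

/-- `K`'s CONCLUSION for the slice development `𝒟'`, in the weakest form `K` guarantees (the
`η`-closeness clause dropped, `Cᵏ` weakened to `C⁰`): sub-extremal final parameters, complete `𝓘⁺` in
the far-origin sojourn form (ray origins `‖y‖ ≥ afRadius a M + 1`), and SOME region converging to
`g_{M',a'}` in `C⁰` in the Kerr–Schild late-chart gauge. [cite: arXiv210408222, §1] -/
def CaptureConclusion {M a : ℝ} {D' : InitialDataSet 𝓘(ℝ, E3) (Kerr.slice a M)}
    (𝒟' : VacuumCauchyDevelopment D') : Prop :=
  ∃ (M' a' : ℝ) (𝒟oc : Set 𝒟'.carrier), Kerr.IsSubextremal M' a' ∧ (∀ [𝒟'.metric.HasLeviCivita], ∃ B₀ : Set (Kerr.slice a M), IsCompact B₀ ∧ ∀ σ : ℝ, 0 < σ → ∃ B₁ : Set (Kerr.slice a M), IsCompact B₁ ∧ ∀ p : Kerr.slice a M, Kerr.afRadius a M + 1 ≤ ‖(p : E3)‖ → p ∉ B₁ → ∀ (γ : ℝ → 𝒟'.carrier) (dom : Set ℝ), 𝒟'.metric.IsNormalisedNullRayFrom 𝒟'.timeOrientation 𝒟'.embed 𝒟'.normal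 p γ dom → ¬ BddAbove dom ∨ ENNReal.ofReal σ ≤ sojournTime γ dom (𝒟'.metric.causalFuture 𝒟'.timeOrientation (𝒟'.embed '' B₀))) ∧ 𝒟'.toSpacetime.ConvergesToKerr 𝒟oc M' a' 0

/-- ORIENTATION LEMMA for the slice development `𝒟'`: for every late `C⁰`-Kerr embedding
`(τ₀, Ψ)` of a sub-extremal Kerr exterior into `𝒟'` (any region) and every truncation radius `ρ`,
eventually in chart time `τ`, the truncated slab `Ψ({t* = τ, r ≤ ρ})` lies in the causal future of
the NEAR part `ι'({‖y‖ ≤ afRadius a M + 1})` of the Cauchy slice and the push-forward of the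
background's future timelike field `V_{M',a'} = −g♯(dt*)` (`Kerr.timeVector`) is future-directed
there. (`Spacetime.IsLateEmbedding`/`ConvergesTo` pin no time orientation — the refuter's
`exists_convergesToKerr_iff` on this item; for near-Kerr `𝒟'` this is a rigidity property: a
strong-field late Kerr region fits nowhere but in the future exterior, and late near zones are
reached from near the hole. Full slabs are NOT eventually in that future: at fixed `t*` only
`r ≲ t*` is.) [cite: arXiv08110354, §5.1] -/
def OrientationLemma {M a : ℝ} {D' : InitialDataSet 𝓘(ℝ, E3) (Kerr.slice a M)}
    (𝒟' : VacuumCauchyDevelopment D') : Prop :=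
  ∀ (M' a' τ₀ : ℝ) (𝒟oc : Set 𝒟'.carrier) (Ψ : (Kerr.background M' a').domain → 𝒟'.carrier), Kerr.IsSubextremal M' a' → 𝒟'.toSpacetime.IsLateEmbedding (Kerr.background M' a') 𝒟oc τ₀ Ψ → Filter.Tendsto (fun τ ↦ 𝒟'.toSpacetime.deviationCk (Kerr.background M' a') Ψ 0 τ) Filter.atTop (nhds 0) → ∀ ρ : ℝ, ∀ᶠ τ in Filter.atTop, ∀ x ∈ (Kerr.background M' a').truncTimeSlab ρ τ, Ψ x ∈ 𝒟'.metric.causalFuture 𝒟'.timeOrientation (𝒟'.embed '' {y : Kerr.slice a M | ‖(y : E3)‖ ≤ Kerr.afRadius a M + 1}) ∧ 𝒟'.timeOrientation.IsFutureDirected (mfderiv 𝓘(ℝ, E4) (𝓡 4) Ψ x (Kerr.timeVector M' a' (x : E4)))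

omit [Kerr.SliceFacts] in
/-- `𝒟` CONTAINS A KERR–SCHILD CAPTURE SLICE at Sobolev scale `(s, δ)` and thresholds `ε`: granted the
Kerr–Schild facts, there are sub-extremal `(M, a)`, `η > 0`, a vacuum datum `D'` on `Kerr.slice a M`
within `ε(M, a, η)` of `Kerr.data M a M` in `H^s_δ × H^{s-1}_{δ+1}` — i.e. IN `K`'s BALL — and a maximal
development `𝒟'` of `D'` embedded into `𝒟` (near part of the slice after the data) and satisfying the
orientation lemma.
[cite: arXiv08110354, Conj. 5.1] -/
def SliceCaptured (s : ℕ) (δ : ℝ) (ε : ℝ → ℝ → ℝ → ℝ) {D : InitialDataSet (𝓡 3) X}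
    (𝒟 : VacuumCauchyDevelopment D) : Prop :=
  ∀ [Kerr.Facts] [Kerr.SliceFacts], ∃ (M a : ℝ) (h : Kerr.IsSubextremal M a) (η : ℝ), 0 < η ∧
    ∃ (D' : InitialDataSet 𝓘(ℝ, E3) (Kerr.slice a M)) (𝒟' : VacuumCauchyDevelopment D')
      (ψ : 𝒟'.carrier → 𝒟.carrier),
      𝒟'.IsMaximal ∧ EmbedsAfterData 𝒟' 𝒟 ψ ∧ (∀ [D'.metric.HasLeviCivita], D'.IsVacuumConstraintSolution) ∧
        InitialDataSet.dataWeightedSobolevEDist s δ D' (Kerr.data M a M h.pos.le) < ENNReal.ofReal (ε M a η) ∧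
          OrientationLemma 𝒟'

omit [Kerr.SliceFacts] in
/-- THE K-BASIN at scale `(s, δ, ε)`: every MGHD of `D` contains a Kerr–Schild capture slice and
satisfies the interior lemma. [cite: arXiv08110354, Conj. 5.1] -/
def KerrBasin (s : ℕ) (δ : ℝ) (ε : ℝ → ℝ → ℝ → ℝ) (D : InitialDataSet (𝓡 3) X) : Prop :=
  ∀ 𝒟 : VacuumCauchyDevelopment D, 𝒟.IsMaximal → SliceCaptured s δ ε 𝒟 ∧ InteriorLemma 𝒟

end Vocabulary

/-! ## §1 Named statements of the three stubs (readable form) -/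

/-- Statement of `stub_mghdExists` (S0): MGHD existence for admissible data — verbatim the shared
route item `MGHDExists`. [cite: Ringstrom2009, Thm. 16.6] -/
def MGHDExistence : Prop :=
  ∀ (X : Type) [TopologicalSpace X] [ChartedSpace Literature.Geometry.Lorentzian.E3 X] [IsManifold (𝓡 3) ((⊤ : ℕ∞) : WithTop ℕ∞) X] [T2Space X] [SecondCountableTopology X] [ConnectedSpace X], ∀ D ∈ Literature.Geometry.Lorentzian.admissibleVacuumData X, ∃ 𝒟 : Literature.Geometry.Lorentzian.VacuumCauchyDevelopment D, 𝒟.IsMaximal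

/-- Statement of `stub_captureTransfer` (S1): the pointwise transfer on the K-basin. -/
def CaptureTransfer : Prop :=
  ∀ (X : Type) [TopologicalSpace X] [ChartedSpace E3 X] [IsManifold (𝓡 3) ∞ X] [T2Space X]
    [SecondCountableTopology X] [ConnectedSpace X], ∀ D ∈ admissibleVacuumData X,
    ∀ (𝒟 : VacuumCauchyDevelopment D), 𝒟.IsMaximal → ∀ [Kerr.Facts] [Kerr.SliceFacts], ∀ (M a : ℝ),
      Kerr.IsSubextremal M a → ∀ (D' : InitialDataSet 𝓘(ℝ, E3) (Kerr.slice a M))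
        (𝒟' : VacuumCauchyDevelopment D') (ψ : 𝒟'.carrier → 𝒟.carrier), 𝒟'.IsMaximal →
          EmbedsAfterData 𝒟' 𝒟 ψ → CaptureConclusion 𝒟' → OrientationLemma 𝒟' → InteriorLemma 𝒟 →
            SummitConclusion 𝒟

/-- Statement of `stub_largeDataRemainder` (S2): the summit's property, tame-generically, OFF the
K-basin, at every scale. -/
def LargeDataRemainder : Prop :=
  ∀ (s : ℕ) (δ : ℝ) (εf : ℝ → ℝ → ℝ → ℝ), (∀ (M a η : ℝ), Kerr.IsSubextremal M a → 0 < η → 0 < εf M a η) →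
    ∀ (X : Type) [TopologicalSpace X] [ChartedSpace E3 X] [IsManifold (𝓡 3) ∞ X] [T2Space X]
      [SecondCountableTopology X] [ConnectedSpace X],
      InitialDataSet.IsTameChristodoulouGeneric (admissibleVacuumData X)
        (fun D ↦ ¬ KerrBasin s δ εf D → SummitProperty D) 1

namespace Goal
/-- Statement of `stub_mghdExists`, under the stub's name. -/
abbrev stub_mghdExists : Prop := MGHDExistence
/-- Statement of `stub_captureTransfer`, under the stub's name. -/
abbrev stub_captureTransfer : Prop := CaptureTransfer
/-- Statement of `stub_largeDataRemainder`, under the stub's name. -/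
abbrev stub_largeDataRemainder : Prop := LargeDataRemainder
end Goal

/-! ## §2 Registered stubs (the only `sorry`s of the file), stated EXPANDED over tree declarations -/

/-- **Stub S0** (`stub_mghdExists`; XL formalisation, classical): every admissible datum — complete,
one-ended, asymptotically flat vacuum data — has a maximal vacuum Cauchy development (MGHD).
Choquet-Bruhat–Geroch, CMP 14 (1969), Theorem p. 331; Ringström 2009, Thm. 16.6; Sbierski, AHP 17
(2016), Thm. 2.6. Verbatim the shared route item `MGHDExists` (ExactKerrEnds, GlobalAttraction,
EternalPapapetrou, BartnikGapSettling) and the stub of the same name in the registered skeletons of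
`GenericCensoredCapture` / `GenericCensoredHolesSettle`. [cite: Ringstrom2009, Thm. 16.6] -/
theorem stub_mghdExists :
    ∀ (X : Type) [TopologicalSpace X] [ChartedSpace Literature.Geometry.Lorentzian.E3 X] [IsManifold (𝓡 3) ((⊤ : ℕ∞) : WithTop ℕ∞) X] [T2Space X] [SecondCountableTopology X] [ConnectedSpace X], ∀ D ∈ Literature.Geometry.Lorentzian.admissibleVacuumData X, ∃ 𝒟 : Literature.Geometry.Lorentzian.VacuumCauchyDevelopment D, 𝒟.IsMaximal := by
  sorry

/-- **Stub S1** (`stub_captureTransfer`; POINTWISE, L/XL — the stub that consumes `K`): for an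
admissible `D` on `X`, an MGHD `𝒟` of `D`, sub-extremal `(M, a)`, a datum `D'` on the Kerr–Schild
slice domain `Kerr.slice a M` with a MAXIMAL vacuum Cauchy development `𝒟'` and a smooth, open,
isometric, time-orientation-preserving embedding `ψ : 𝒟' → 𝒟` placing the near part of the slice
(`‖y‖ ≤ afRadius a M + 1`) in `J⁺(ι X)`: if
`𝒟'` has `K`'s conclusion in its weakest guaranteed form (sub-extremal `(M', a')`; complete `𝓘⁺` in
the far-origin sojourn form; SOME region `C⁰`-converging to `g_{M',a'}` in the Kerr–Schild late-chart
gauge), if the truncated late slabs of every late `C⁰`-Kerr embedding into `𝒟'` lie eventually in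
`J⁺` of the near part of its slice with `Ψ_* V` future-directed (orientation lemma), and if every honest `C²` decomposition of `𝒟` keeps the future-complete null
rays from `Σ` in the closure of its exterior (interior lemma), then `𝒟` has complete `𝓘⁺` and an
honest `C²` sub-extremal Kerr final-state decomposition of its self-determined exterior with
`RaysStayInClosure`, `HasExhaustiveCharts` (honest, horizon-filling radii) and `IsFutureOriented`.
Transfer of sojourn completeness `Σ' ↝ Σ` (monotone; footprints of compact sets below `Σ` are compact),
push-forward, horizon-filling recut and far-zone bending of the late chart, `N = 1` decomposition with the flat chart read off the Kerr chart beyond a sublinear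
excision, `C⁰ ⇒ C²` upgrade by the vacuum equations. [cite: DafermosLuk2017, Conjecture 1]
[cite: arXiv210408222, §1] -/
theorem stub_captureTransfer :
    ∀ (X : Type) [TopologicalSpace X] [ChartedSpace E3 X] [IsManifold (𝓡 3) ∞ X] [T2Space X] [SecondCountableTopology X] [ConnectedSpace X], ∀ D ∈ admissibleVacuumData X, ∀ (𝒟 : VacuumCauchyDevelopment D), 𝒟.IsMaximal → ∀ [Kerr.Facts] [Kerr.SliceFacts], ∀ (M a : ℝ), Kerr.IsSubextremal M a → ∀ (D' : InitialDataSet 𝓘(ℝ, E3) (Kerr.slice a M)) (𝒟' : VacuumCauchyDevelopment D') (ψ : 𝒟'.carrier → 𝒟.carrier), 𝒟'.IsMaximal → (ContMDiff (𝓡 4) (𝓡 4) ∞ ψ ∧ Topology.IsOpenEmbedding ψ ∧ 𝒟'.metric.IsIsometricImmersion 𝒟.metric.toPseudoRiemannianMetric ψ ∧ 𝒟'.timeOrientation.PreservesTimeOrientation ψ 𝒟.timeOrientation ∧ ∀ y : Kerr.slice a M, ‖(y : E3)‖ ≤ Kerr.afRadius a M + 1 → ψ (𝒟'.embed y) ∈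 𝒟.metric.causalFuture 𝒟.timeOrientation (range 𝒟.embed)) → (∃ (M' a' : ℝ) (𝒟oc : Set 𝒟'.carrier), Kerr.IsSubextremal M' a' ∧ (∀ [𝒟'.metric.HasLeviCivita], ∃ B₀ : Set (Kerr.slice a M), IsCompact B₀ ∧ ∀ σ : ℝ, 0 < σ → ∃ B₁ : Set (Kerr.slice a M), IsCompact B₁ ∧ ∀ p : Kerr.slice a M, Kerr.afRadius a M + 1 ≤ ‖(p : E3)‖ → p ∉ B₁ → ∀ (γ : ℝ → 𝒟'.carrier) (dom : Set ℝ), 𝒟'.metric.IsNormalisedNullRayFrom 𝒟'.timeOrientation 𝒟'.embed 𝒟'.normal p γ dom → ¬ BddAbove dom ∨ ENNReal.ofReal σ ≤ sojournTime γ dom (𝒟'.metric.causalFuture 𝒟'.timeOrientation (𝒟'.embed '' B₀))) ∧ 𝒟'.toSpacetime.ConvergesToKerr 𝒟oc M' a' 0) → (∀ (M' a' τ₀ : ℝ) (𝒟oc : Set 𝒟'.carrier) (Ψ : (Kerr.background M' a').domain → 𝒟'.carrier), Kerr.IsSubextremal M' a' → 𝒟'.toSpacetime.IsLateEmbedding (Kerr.background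 M' a') 𝒟oc τ₀ Ψ → Filter.Tendsto (fun τ ↦ 𝒟'.toSpacetime.deviationCk (Kerr.background M' a') Ψ 0 τ) Filter.atTop (nhds 0) → ∀ ρ : ℝ, ∀ᶠ τ in Filter.atTop, ∀ x ∈ (Kerr.background M' a').truncTimeSlab ρ τ, Ψ x ∈ 𝒟'.metric.causalFuture 𝒟'.timeOrientation (𝒟'.embed '' {y : Kerr.slice a M | ‖(y : E3)‖ ≤ Kerr.afRadius a M + 1}) ∧ 𝒟'.timeOrientation.IsFutureDirected (mfderiv 𝓘(ℝ, E4) (𝓡 4) Ψ x (Kerr.timeVector M' a' (x : E4)))) → (∀ (O : Set 𝒟.carrier) (d : FinalStateDecomposition 𝒟.toSpacetime O 2), (∀ i, Kerr.IsSubextremal (d.mass i) (d.spin i)) → O = Summit.FinalStateConjecture.exteriorOf 𝒟.toCauchyDevelopment d.charted → Summit.FinalStateConjecture.HasExhaustiveCharts d → Summit.FinalStateConjecture.IsFutureOriented d → Summit.FinalStateConjecture.RaysStayInClosure 𝒟.toCauchyDevelopment O) → Summit.FinalStateConjecture.HasCompleteNullInfinity 𝒟.toCauchyDevelopment ∧ ∃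 (O : Set 𝒟.carrier) (d : FinalStateDecomposition 𝒟.toSpacetime O 2), (∀ i, Kerr.IsSubextremal (d.mass i) (d.spin i)) ∧ O = Summit.FinalStateConjecture.exteriorOf 𝒟.toCauchyDevelopment d.charted ∧ Summit.FinalStateConjecture.RaysStayInClosure 𝒟.toCauchyDevelopment O ∧ Summit.FinalStateConjecture.HasExhaustiveCharts d ∧ Summit.FinalStateConjecture.IsFutureOriented d := by
  sorry

/-- **Stub S2** (`stub_largeDataRemainder`; GENERIC, open problem — the summit off the K-basin): for
every Sobolev scale `(s, δ)` and every threshold function `ε(M, a, η) > 0` on the sub-extremal range,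
and every data manifold `X`, TAME-Christodoulou-generically in `admissibleVacuumData X` (codimension
`1`, witness curves on one fixed end): a datum NOT in the K-basin — not every MGHD of it contains a
Kerr–Schild capture slice at scale `ε` (a vacuum datum on some `Kerr.slice a M` within `ε(M, a, η)` of
`Kerr.data M a M`, with a maximal development embedded, near part of the slice after the data,
oriented) together with the interior lemma — has an MGHD, and all its MGHDs have complete `𝓘⁺` and settle to finitely many
sub-extremal Kerr black holes in the summit's honest sense. Weak cosmic censorship and the final
state for all tame-generic data that perturbation theory around Kerr cannot reach: dispersal,
several holes, non-perturbative single-hole collapse. A consequence of the summit used toward it.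
[cite: DafermosLuk2017, §1.2.1] [cite: Christodoulou1999, p. A24] -/
theorem stub_largeDataRemainder :
    ∀ (s : ℕ) (δ : ℝ) (εf : ℝ → ℝ → ℝ → ℝ), (∀ (M a η : ℝ), Kerr.IsSubextremal M a → 0 < η → 0 < εf M a η) → ∀ (X : Type) [TopologicalSpace X] [ChartedSpace E3 X] [IsManifold (𝓡 3) ∞ X] [T2Space X] [SecondCountableTopology X] [ConnectedSpace X], InitialDataSet.IsTameChristodoulouGeneric (admissibleVacuumData X) (fun D ↦ ¬ (∀ 𝒟 : VacuumCauchyDevelopment D, 𝒟.IsMaximal → (∀ [Kerr.Facts] [Kerr.SliceFacts], ∃ (M a : ℝ) (h : Kerr.IsSubextremal M a) (η : ℝ), 0 < η ∧ ∃ (D' : InitialDataSet 𝓘(ℝ, E3) (Kerr.slice a M)) (𝒟' : VacuumCauchyDevelopment D') (ψ : 𝒟'.carrier → 𝒟.carrier), 𝒟'.IsMaximal ∧ (ContMDiff (𝓡 4) (𝓡 4) ∞ ψ ∧ Topology.IsOpenEmbedding ψ ∧ 𝒟'.metric.IsIsometricImmersion 𝒟.metric.toPseudoRiemannianMetric ψ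 ∧ 𝒟'.timeOrientation.PreservesTimeOrientation ψ 𝒟.timeOrientation ∧ ∀ y : Kerr.slice a M, ‖(y : E3)‖ ≤ Kerr.afRadius a M + 1 → ψ (𝒟'.embed y) ∈ 𝒟.metric.causalFuture 𝒟.timeOrientation (range 𝒟.embed)) ∧ (∀ [D'.metric.HasLeviCivita], D'.IsVacuumConstraintSolution) ∧ InitialDataSet.dataWeightedSobolevEDist s δ D' (Kerr.data M a M h.pos.le) < ENNReal.ofReal (εf M a η) ∧ (∀ (M' a' τ₀ : ℝ) (𝒟oc : Set 𝒟'.carrier) (Ψ : (Kerr.background M' a').domain → 𝒟'.carrier), Kerr.IsSubextremal M' a' → 𝒟'.toSpacetime.IsLateEmbedding (Kerr.background M' a') 𝒟oc τ₀ Ψ → Filter.Tendsto (fun τ ↦ 𝒟'.toSpacetime.deviationCk (Kerr.background M' a') Ψ 0 τ) Filter.atTop (nhds 0) → ∀ ρ : ℝ, ∀ᶠ τ in Filter.atTop, ∀ x ∈ (Kerr.background M' a').truncTimeSlab ρ τ, Ψ x ∈ 𝒟'.metric.causalFuture 𝒟'.timeOrientation (𝒟'.embed '' {y : Kerr.slice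 a M | ‖(y : E3)‖ ≤ Kerr.afRadius a M + 1}) ∧ 𝒟'.timeOrientation.IsFutureDirected (mfderiv 𝓘(ℝ, E4) (𝓡 4) Ψ x (Kerr.timeVector M' a' (x : E4))))) ∧ (∀ (O : Set 𝒟.carrier) (d : FinalStateDecomposition 𝒟.toSpacetime O 2), (∀ i, Kerr.IsSubextremal (d.mass i) (d.spin i)) → O = Summit.FinalStateConjecture.exteriorOf 𝒟.toCauchyDevelopment d.charted → Summit.FinalStateConjecture.HasExhaustiveCharts d → Summit.FinalStateConjecture.IsFutureOriented d → Summit.FinalStateConjecture.RaysStayInClosure 𝒟.toCauchyDevelopment O)) → ((∃ 𝒟 : VacuumCauchyDevelopment D, 𝒟.IsMaximal) ∧ ∀ 𝒟 : VacuumCauchyDevelopment D, 𝒟.IsMaximal → Summit.FinalStateConjecture.HasCompleteNullInfinity 𝒟.toCauchyDevelopment ∧ ∃ (O : Set 𝒟.carrier) (d : FinalStateDecomposition 𝒟.toSpacetime O 2), (∀ i, Kerr.IsSubextremal (d.mass i) (d.spin i)) ∧ O = Summit.FinalStateConjecture.exteriorOf 𝒟.toCauchyDevelopment d.charted ∧ Summit.FinalStateConjecture.RaysStayInClosure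 𝒟.toCauchyDevelopment O ∧ Summit.FinalStateConjecture.HasExhaustiveCharts d ∧ Summit.FinalStateConjecture.IsFutureOriented d)) 1 := by
  sorry

/-! Consistency (elaborated, not kept): each expanded stub statement is, by `δ`-unfolding, the named
proposition the composition consumes. -/
example : Goal.stub_mghdExists := stub_mghdExists
example : Goal.stub_captureTransfer := stub_captureTransfer
example : Goal.stub_largeDataRemainder := stub_largeDataRemainder

/-! ## §3 The composition (kernel-checked; no `sorry` of its own) -/

/-- The Kerr–Schild chart facts are theorems of the tree (`KerrDataProofs`, `KerrSchildCoord`).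
[folklore] -/
theorem kerrFacts : Kerr.Facts :=
  ⟨Kerr.isConnected_region_holds, Kerr.contMDiff_bilin_holds, Kerr.contMDiff_timeVector_holds⟩

/-- THE CRUX BY NAME from the three registered stubs. Discharge `[Kerr.Facts] [Kerr.SliceFacts]`,
open `K` to `(s, δ, k)`, choose `K`'s thresholds `ε(M, a, η)`, run the remainder S2 at them, and glue by
monotonicity of tame genericity: off the basin S2 concludes; on the basin S0 gives the MGHD and, per
MGHD, the captured slice is fed to `K` and the output (weakened to `C⁰`) to the transfer S1. -/
theorem FinalStateFromKerrCapture_of :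
    Goal.stub_mghdExists → Goal.stub_captureTransfer → Goal.stub_largeDataRemainder →
      Summit.FinalStateConjecture.FinalStateConjecture.Theses.StorageCertificates.FinalStateFromKerrCapture := by
  intro h0 h1 h2 hK X _ _ _ _ _ _
  haveI hKF : Kerr.Facts := kerrFacts
  haveI hKS : Kerr.SliceFacts := Kerr.sliceFacts_holds
  -- open the waypoint: Sobolev scale `(s, δ)`, regularity `k`, thresholds `ε(M, a, η)`
  obtain ⟨s, δ, k, hk⟩ := @hK hKF hKS
  have hε : ∃ εf : ℝ → ℝ → ℝ → ℝ,
      (∀ (M a η : ℝ), Kerr.IsSubextremal M a → 0 < η → 0 < εf M a η) ∧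
        ∀ (M a : ℝ) (hMa : Kerr.IsSubextremal M a) (η : ℝ), 0 < η →
          ∀ (D : InitialDataSet 𝓘(ℝ, E3) (Kerr.slice a M)) [D.metric.HasLeviCivita], D.IsVacuumConstraintSolution → InitialDataSet.dataWeightedSobolevEDist s δ D (Kerr.data M a M hMa.pos.le) < ENNReal.ofReal (εf M a η) → ∀ 𝒟 : VacuumCauchyDevelopment D, 𝒟.IsMaximal → ∃ (M' a' : ℝ) (𝒟oc : Set 𝒟.carrier), Kerr.IsSubextremal M' a' ∧ |M' - M| + |a' - a| ≤ η ∧ (∀ [𝒟.metric.HasLeviCivita], ∃ B₀ : Set (Kerr.slice a M), IsCompact B₀ ∧ ∀ σ : ℝ, 0 < σ → ∃ B₁ : Set (Kerr.slice a M), IsCompact B₁ ∧ ∀ p : Kerr.slice a M, Kerr.afRadius a M + 1 ≤ ‖(p : E3)‖ → p ∉ B₁ → ∀ (γ : ℝ → 𝒟.carrier) (dom : Set ℝ), 𝒟.metric.IsNormalisedNullRayFrom 𝒟.timeOrientation 𝒟.embed 𝒟.normal p γ dom → ¬ BddAbove dom ∨ ENNReal.ofReal σ ≤ sojournTime γ dom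 (𝒟.metric.causalFuture 𝒟.timeOrientation (𝒟.embed '' B₀))) ∧ 𝒟.toSpacetime.ConvergesToKerr 𝒟oc M' a' k := by
    refine ⟨fun M a η ↦ if hq : Kerr.IsSubextremal M a ∧ 0 < η then
      Classical.choose (hk M a hq.1 η hq.2) else 1, ?_, ?_⟩
    · intro M a η hMa hη
      simp only [dif_pos (And.intro hMa hη)]
      exact (Classical.choose_spec (hk M a hMa η hη)).1
    · intro M a hMa η hη
      simp only [dif_pos (And.intro hMa hη)]
      exact (Classical.choose_spec (hk M a hMa η hη)).2
  obtain ⟨εf, hεf, hεK⟩ := hε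
  -- the remainder at these thresholds; tame genericity is monotone in the property
  refine (h2 s δ εf hεf X).mono fun D hD hrem ↦ ?_
  by_cases hB : KerrBasin s δ εf D
  · -- ON THE BASIN: S0 gives the MGHD; per MGHD, `K` on the captured slice, then the transfer S1
    refine ⟨h0 X D hD, fun 𝒟 h𝒟 ↦ ?_⟩
    obtain ⟨hcap, hint⟩ := hB 𝒟 h𝒟
    obtain ⟨M, a, hMa, η, hη, D', 𝒟', ψ, hmax, hψ, hvac, hdist, hor⟩ := @hcap hKF hKS
    haveI := D'.metric.hasLeviCivita
    obtain ⟨M', a', 𝒟oc, hsub, -, hfar, hconv⟩ := hεK M a hMa η hη D' hvac hdist 𝒟' hmax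
    exact h1 X D hD 𝒟 h𝒟 M a hMa D' 𝒟' ψ hmax hψ
      ⟨M', a', 𝒟oc, hsub, hfar, Spacetime.ConvergesTo.of_le hconv (Nat.zero_le k)⟩ hor hint
  · -- OFF THE BASIN: the remainder is the summit's property
    exact hrem hB

end Summit.FinalStateConjecture.FinalStateConjecture.Cruxes.FinalStateFromKerrCapture.Birth

end
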